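import Mathlib
import Summits.Ventures.PercRepro2.SLevelCDTwoRootDefs

/-!
# (CD) holds when `a₃` is adjacent only to the two roots — the two-root class of the
covariance-monotone statement (blind cell PercRepro2, mine-c g12; mine-a g11 MINEA-CD.md §5 Theorem B
with the pocket `P = {a₃}`, paper; the definitions and the double-pinning lemmas are in
`SLevelCDTwoRootDefs.lean`)

Let `e₁ = {a₁, a₃}`, `e₂ = {a₂, a₃}` be the only edges at `a₃` (`IsTwoRootAt`), `o ≠ a₃`. Under
`Q = {a₁ ↮ a₂}` the pair `(e₁, e₂)` is never `(open, open)`, case 1 is `(open, closed)`, `PD` is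
`(closed, closed)`, and every connection event among the other vertices sees the configuration with both
edges closed. Then for every increasing `F`,
  `covS F φ = a c q′ · [ (1 − p₁p₂)(q′X − ZY) − (1 − p₁) M₁ (Y − Y⁰) ]`
with `a = p₁(1−p₂)`, `c = (1−p₁)(1−p₂)`, `q′ = P(Q)` of the base world, `X, Y` the case-1 expectations,
`Y⁰` the base one, `Z = P(Q, o∈C₂)`, `M₁ = P(Q, o∈C₁)`; `q′X ≤ ZY` is BHK06 Thm 1.4 (functional) in the
case-1 world and `Y⁰ ≤ Y` is the monotonicity of `F` — so `covS F φ ≤ 0`: **`cd_of_two_root`**.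
The leaf class `cd_of_leaf` (SLevelCDLeaf.lean) is the case `p₂ = 0`. Nothing beyond is claimed. -/

namespace Summit.Ventures.PercRepro2

open UnionCluster

namespace SLevel

section TwoRootMain

variable {V : Type*} {E : Type*} [Fintype E] [DecidableEq E] [Fintype V] [DecidableEq V]
  {R : Type*} [Field R] [LinearOrder R] [IsStrictOrderedRing R]

variable (p : E → R) (ends : E → Sym2 V) (o a₁ a₂ a₃ : V) (e₁ e₂ : E)

local notation3 "Q" => avoidAll ends a₂ {a₁}
local notation3 "𝟙Q" => (avoidAll ends a₂ {a₁}).indicator (1 : Config E → R)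
local notation3 "𝟙e" => (connEvent ends a₁ a₃).indicator (1 : Config E → R)
local notation3 "𝟙f" => (connEvent ends a₂ o).indicator (1 : Config E → R)
local notation3 "𝟙o₁" => (connEvent ends a₁ o).indicator (1 : Config E → R)
local notation3 "D" => prob p (PDEvent ends a₁ a₂ a₃)
local notation3 "Dₒ" => CovForm.Do p ends o a₁ a₂ a₃

variable {ends a₁ a₂ a₃ e₁ e₂}


omit [DecidableEq V] in
/-- **(CD) holds when `a₃` is adjacent only to the two roots** (`o ≠ a₃`): mine-a's Theorem B with the
pocket `P = {a₃}`, at `S`-level and for every increasing `F` — the two-root class of (CD). -/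
theorem cd_of_two_root (hp : IsProbVec p) (h : IsTwoRootAt ends a₁ a₂ a₃ e₁ e₂) (ho : o ≠ a₃) :
    CD p ends o a₁ a₂ a₃ := by
  intro F hF
  rw [← covS_sub_const_left p ends a₁ a₂ F (phi p ends o a₁ a₂ a₃) (F ∅)]
  set G : Set V → R := fun W => F W - F ∅ with hGdef
  have hG : Monotone G := fun W W' hW => by
    show F W - F ∅ ≤ F W' - F ∅
    linarith [hF hW]
  have hG0 : ∀ W : Set V, 0 ≤ G W := fun W => by
    show 0 ≤ F W - F ∅
    linarith [hF (Set.empty_subset W)]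
  rw [covS_phi_eq_omega]
  -- invariances
  have hfu_tf : ∀ ω : Config E, 𝟙f (upd e₁ e₂ true false ω) = 𝟙f (base e₁ e₂ ω) :=
    fun ω => ind_upd_tf h h.ne₂ ho ω
  have hfu_ft : ∀ ω : Config E, 𝟙f (upd e₁ e₂ false true ω) = 𝟙f (base e₁ e₂ ω) :=
    fun ω => ind_upd_ft h h.ne₂ ho ω
  have hQ_tt : ∀ ω : Config E, 𝟙Q (upd e₁ e₂ true true ω) = 0 := indQ_upd_tt h
  have hQ_tf : ∀ ω : Config E, 𝟙Q (upd e₁ e₂ true false ω) = 𝟙Q (base e₁ e₂ ω) := indQ_upd_tf h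
  have hQ_ft : ∀ ω : Config E, 𝟙Q (upd e₁ e₂ false true ω) = 𝟙Q (base e₁ e₂ ω) := indQ_upd_ft h
  have he_tf : ∀ ω : Config E, 𝟙e (upd e₁ e₂ true false ω) = 1 := inde_upd_tf h
  have heQ_ft : ∀ ω : Config E, 𝟙e (upd e₁ e₂ false true ω) * 𝟙Q (upd e₁ e₂ false true ω) = 0 :=
    inde_indQ_upd_ft h
  have he_ff : ∀ ω : Config E, 𝟙e (base e₁ e₂ ω) = 0 := inde_base h
  have hcl_ft : ∀ ω : Config E, G (cluster ends (upd e₁ e₂ false true ω) a₁) *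
      𝟙Q (upd e₁ e₂ false true ω) = G (cluster ends (base e₁ e₂ ω) a₁) * 𝟙Q (base e₁ e₂ ω) := by
    intro ω
    by_cases hQ : upd e₁ e₂ false true ω ∈ Q
    · rw [cluster_upd_ft h ω hQ, hQ_ft]
    · rw [Set.indicator_of_notMem hQ,
        Set.indicator_of_notMem (show base e₁ e₂ ω ∉ Q from fun h' => hQ ((mem_Q_upd_ft h ω).2 h'))]
      simp
  -- abbreviations
  set q := expect p (fun ω => 𝟙Q (base e₁ e₂ ω)) with hq
  set X := expect p (fun ω => G (cluster ends (upd e₁ e₂ true false ω) a₁) * 𝟙f (base e₁ e₂ ω) *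
    𝟙Q (base e₁ e₂ ω)) with hX
  set Y := expect p (fun ω => G (cluster ends (upd e₁ e₂ true false ω) a₁) * 𝟙Q (base e₁ e₂ ω)) with hY
  set Y0 := expect p (fun ω => G (cluster ends (base e₁ e₂ ω) a₁) * 𝟙Q (base e₁ e₂ ω)) with hY0
  set Z := expect p (fun ω => 𝟙f (base e₁ e₂ ω) * 𝟙Q (base e₁ e₂ ω)) with hZ
  set M := expect p (fun ω => 𝟙o₁ (base e₁ e₂ ω) * 𝟙Q (base e₁ e₂ ω)) with hM
  have hp1 : 0 ≤ p e₁ := hp.nonneg e₁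
  have hp1' : p e₁ ≤ 1 := hp.le_one e₁
  have hp2 : 0 ≤ p e₂ := hp.nonneg e₂
  have hp2' : p e₂ ≤ 1 := hp.le_one e₂
  -- the expectation identities (double pinning; the `(open, open)` world has `𝟙Q = 0`)
  have hE1 : expect p (fun ω => G (cluster ends ω a₁) * 𝟙e ω * 𝟙f ω * 𝟙Q ω) = p e₁ * (1 - p e₂) * X := by
    rw [expect_split2 (e₁ := e₁) (e₂ := e₂) p]
    have t1 : expect p (fun ω => G (cluster ends (upd e₁ e₂ true true ω) a₁) *
        𝟙e (upd e₁ e₂ true true ω) * 𝟙f (upd e₁ e₂ true true ω) * 𝟙Q (upd e₁ e₂ true true ω)) = 0 := by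
      rw [show (fun ω => G (cluster ends (upd e₁ e₂ true true ω) a₁) * 𝟙e (upd e₁ e₂ true true ω) *
          𝟙f (upd e₁ e₂ true true ω) * 𝟙Q (upd e₁ e₂ true true ω)) = fun _ => (0 : R) from by
        funext ω; rw [hQ_tt]; ring]
      simp [expect]
    have t3 : expect p (fun ω => G (cluster ends (upd e₁ e₂ false true ω) a₁) *
        𝟙e (upd e₁ e₂ false true ω) * 𝟙f (upd e₁ e₂ false true ω) * 𝟙Q (upd e₁ e₂ false true ω)) = 0 := by
      rw [show (fun ω => G (cluster ends (upd e₁ e₂ false true ω) a₁) * 𝟙e (upd e₁ e₂ false true ω) *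
          𝟙f (upd e₁ e₂ false true ω) * 𝟙Q (upd e₁ e₂ false true ω)) = fun _ => (0 : R) from by
        funext ω
        have := heQ_ft ω
        calc G (cluster ends (upd e₁ e₂ false true ω) a₁) * 𝟙e (upd e₁ e₂ false true ω) *
              𝟙f (upd e₁ e₂ false true ω) * 𝟙Q (upd e₁ e₂ false true ω)
            = G (cluster ends (upd e₁ e₂ false true ω) a₁) * 𝟙f (upd e₁ e₂ false true ω) *
              (𝟙e (upd e₁ e₂ false true ω) * 𝟙Q (upd e₁ e₂ false true ω)) := by ring
          _ = 0 := by rw [this]; ring]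
      simp [expect]
    have t4 : expect p (fun ω => G (cluster ends (upd e₁ e₂ false false ω) a₁) *
        𝟙e (upd e₁ e₂ false false ω) * 𝟙f (upd e₁ e₂ false false ω) * 𝟙Q (upd e₁ e₂ false false ω)) = 0 := by
      rw [show (fun ω => G (cluster ends (upd e₁ e₂ false false ω) a₁) * 𝟙e (upd e₁ e₂ false false ω) *
          𝟙f (upd e₁ e₂ false false ω) * 𝟙Q (upd e₁ e₂ false false ω)) = fun _ => (0 : R) from by
        funext ω; rw [upd_ff, he_ff]; ring]
      simp [expect]
    rw [t1, t3, t4, hX]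
    have t2 : expect p (fun ω => G (cluster ends (upd e₁ e₂ true false ω) a₁) *
        𝟙e (upd e₁ e₂ true false ω) * 𝟙f (upd e₁ e₂ true false ω) * 𝟙Q (upd e₁ e₂ true false ω)) =
        expect p (fun ω => G (cluster ends (upd e₁ e₂ true false ω) a₁) * 𝟙f (base e₁ e₂ ω) *
          𝟙Q (base e₁ e₂ ω)) := by
      congr 1; funext ω; rw [he_tf, hfu_tf, hQ_tf]; ring
    rw [t2]; ring
  have hE2 : expect p (fun ω => G (cluster ends ω a₁) * 𝟙e ω * 𝟙Q ω) = p e₁ * (1 - p e₂) * Y := by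
    rw [expect_split2 (e₁ := e₁) (e₂ := e₂) p]
    have t1 : expect p (fun ω => G (cluster ends (upd e₁ e₂ true true ω) a₁) *
        𝟙e (upd e₁ e₂ true true ω) * 𝟙Q (upd e₁ e₂ true true ω)) = 0 := by
      rw [show (fun ω => G (cluster ends (upd e₁ e₂ true true ω) a₁) * 𝟙e (upd e₁ e₂ true true ω) *
          𝟙Q (upd e₁ e₂ true true ω)) = fun _ => (0 : R) from by funext ω; rw [hQ_tt]; ring]
      simp [expect]
    have t3 : expect p (fun ω => G (cluster ends (upd e₁ e₂ false true ω) a₁) *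
        𝟙e (upd e₁ e₂ false true ω) * 𝟙Q (upd e₁ e₂ false true ω)) = 0 := by
      rw [show (fun ω => G (cluster ends (upd e₁ e₂ false true ω) a₁) * 𝟙e (upd e₁ e₂ false true ω) *
          𝟙Q (upd e₁ e₂ false true ω)) = fun _ => (0 : R) from by
        funext ω; rw [mul_assoc, heQ_ft]; ring]
      simp [expect]
    have t4 : expect p (fun ω => G (cluster ends (upd e₁ e₂ false false ω) a₁) *
        𝟙e (upd e₁ e₂ false false ω) * 𝟙Q (upd e₁ e₂ false false ω)) = 0 := by
      rw [show (fun ω => G (cluster ends (upd e₁ e₂ false false ω) a₁) * 𝟙e (upd e₁ e₂ false false ω) *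
          𝟙Q (upd e₁ e₂ false false ω)) = fun _ => (0 : R) from by
        funext ω; rw [upd_ff, he_ff]; ring]
      simp [expect]
    rw [t1, t3, t4, hY]
    have t2 : expect p (fun ω => G (cluster ends (upd e₁ e₂ true false ω) a₁) *
        𝟙e (upd e₁ e₂ true false ω) * 𝟙Q (upd e₁ e₂ true false ω)) =
        expect p (fun ω => G (cluster ends (upd e₁ e₂ true false ω) a₁) * 𝟙Q (base e₁ e₂ ω)) := by
      congr 1; funext ω; rw [he_tf, hQ_tf]; ring
    rw [t2]; ring
  have hE3 : expect p (fun ω => G (cluster ends ω a₁) * 𝟙Q ω) =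
      p e₁ * (1 - p e₂) * Y + (1 - p e₁) * Y0 := by
    rw [expect_split2 (e₁ := e₁) (e₂ := e₂) p]
    have t1 : expect p (fun ω => G (cluster ends (upd e₁ e₂ true true ω) a₁) *
        𝟙Q (upd e₁ e₂ true true ω)) = 0 := by
      rw [show (fun ω => G (cluster ends (upd e₁ e₂ true true ω) a₁) * 𝟙Q (upd e₁ e₂ true true ω)) =
          fun _ => (0 : R) from by funext ω; rw [hQ_tt]; ring]
      simp [expect]
    have t2 : expect p (fun ω => G (cluster ends (upd e₁ e₂ true false ω) a₁) *
        𝟙Q (upd e₁ e₂ true false ω)) = Y := by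
      rw [hY]; congr 1; funext ω; rw [hQ_tf]
    have t3 : expect p (fun ω => G (cluster ends (upd e₁ e₂ false true ω) a₁) *
        𝟙Q (upd e₁ e₂ false true ω)) = Y0 := by
      rw [hY0]; congr 1; funext ω; exact hcl_ft ω
    have t4 : expect p (fun ω => G (cluster ends (upd e₁ e₂ false false ω) a₁) *
        𝟙Q (upd e₁ e₂ false false ω)) = Y0 := by
      rw [hY0]; congr 1
    rw [t1, t2, t3, t4]; ring
  have hE4 : expect p (fun ω => 𝟙e ω * 𝟙f ω * 𝟙Q ω) = p e₁ * (1 - p e₂) * Z := by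
    rw [expect_split2 (e₁ := e₁) (e₂ := e₂) p]
    have t1 : expect p (fun ω => 𝟙e (upd e₁ e₂ true true ω) * 𝟙f (upd e₁ e₂ true true ω) *
        𝟙Q (upd e₁ e₂ true true ω)) = 0 := by
      rw [show (fun ω => 𝟙e (upd e₁ e₂ true true ω) * 𝟙f (upd e₁ e₂ true true ω) *
          𝟙Q (upd e₁ e₂ true true ω)) = fun _ => (0 : R) from by funext ω; rw [hQ_tt]; ring]
      simp [expect]
    have t3 : expect p (fun ω => 𝟙e (upd e₁ e₂ false true ω) * 𝟙f (upd e₁ e₂ false true ω) *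
        𝟙Q (upd e₁ e₂ false true ω)) = 0 := by
      rw [show (fun ω => 𝟙e (upd e₁ e₂ false true ω) * 𝟙f (upd e₁ e₂ false true ω) *
          𝟙Q (upd e₁ e₂ false true ω)) = fun _ => (0 : R) from by
        funext ω
        calc 𝟙e (upd e₁ e₂ false true ω) * 𝟙f (upd e₁ e₂ false true ω) * 𝟙Q (upd e₁ e₂ false true ω)
            = 𝟙f (upd e₁ e₂ false true ω) * (𝟙e (upd e₁ e₂ false true ω) * 𝟙Q (upd e₁ e₂ false true ω)) := by
              ring
          _ = 0 := by rw [heQ_ft]; ring]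
      simp [expect]
    have t4 : expect p (fun ω => 𝟙e (upd e₁ e₂ false false ω) * 𝟙f (upd e₁ e₂ false false ω) *
        𝟙Q (upd e₁ e₂ false false ω)) = 0 := by
      rw [show (fun ω => 𝟙e (upd e₁ e₂ false false ω) * 𝟙f (upd e₁ e₂ false false ω) *
          𝟙Q (upd e₁ e₂ false false ω)) = fun _ => (0 : R) from by
        funext ω; rw [upd_ff, he_ff]; ring]
      simp [expect]
    rw [t1, t3, t4, hZ]
    have t2 : expect p (fun ω => 𝟙e (upd e₁ e₂ true false ω) * 𝟙f (upd e₁ e₂ true false ω) *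
        𝟙Q (upd e₁ e₂ true false ω)) =
        expect p (fun ω => 𝟙f (base e₁ e₂ ω) * 𝟙Q (base e₁ e₂ ω)) := by
      congr 1; funext ω; rw [he_tf, hfu_tf, hQ_tf]; ring
    rw [t2]; ring
  have hE5 : expect p (fun ω => 𝟙e ω * 𝟙Q ω) = p e₁ * (1 - p e₂) * q := by
    rw [expect_split2 (e₁ := e₁) (e₂ := e₂) p]
    have t1 : expect p (fun ω => 𝟙e (upd e₁ e₂ true true ω) * 𝟙Q (upd e₁ e₂ true true ω)) = 0 := by
      rw [show (fun ω => 𝟙e (upd e₁ e₂ true true ω) * 𝟙Q (upd e₁ e₂ true true ω)) =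
          fun _ => (0 : R) from by funext ω; rw [hQ_tt]; ring]
      simp [expect]
    have t3 : expect p (fun ω => 𝟙e (upd e₁ e₂ false true ω) * 𝟙Q (upd e₁ e₂ false true ω)) = 0 := by
      rw [show (fun ω => 𝟙e (upd e₁ e₂ false true ω) * 𝟙Q (upd e₁ e₂ false true ω)) =
          fun _ => (0 : R) from by funext ω; exact heQ_ft ω]
      simp [expect]
    have t4 : expect p (fun ω => 𝟙e (upd e₁ e₂ false false ω) * 𝟙Q (upd e₁ e₂ false false ω)) = 0 := by
      rw [show (fun ω => 𝟙e (upd e₁ e₂ false false ω) * 𝟙Q (upd e₁ e₂ false false ω)) =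
          fun _ => (0 : R) from by funext ω; rw [upd_ff, he_ff]; ring]
      simp [expect]
    rw [t1, t3, t4, hq]
    have t2 : expect p (fun ω => 𝟙e (upd e₁ e₂ true false ω) * 𝟙Q (upd e₁ e₂ true false ω)) =
        expect p (fun ω => 𝟙Q (base e₁ e₂ ω)) := by
      congr 1; funext ω; rw [he_tf, hQ_tf]; ring
    rw [t2]; ring
  have hPQ : prob p Q = (1 - p e₁ * p e₂) * q := by
    rw [prob_eq_expect_indicator, expect_split2 (e₁ := e₁) (e₂ := e₂) p 𝟙Q]
    have t1 : expect p (fun ω => 𝟙Q (upd e₁ e₂ true true ω)) = 0 := by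
      rw [show (fun ω => 𝟙Q (upd e₁ e₂ true true ω)) = fun _ => (0 : R) from by
        funext ω; exact hQ_tt ω]
      simp [expect]
    have t2 : expect p (fun ω => 𝟙Q (upd e₁ e₂ true false ω)) = q := by
      rw [hq]; congr 1; funext ω; exact hQ_tf ω
    have t3 : expect p (fun ω => 𝟙Q (upd e₁ e₂ false true ω)) = q := by
      rw [hq]; congr 1; funext ω; exact hQ_ft ω
    have t4 : expect p (fun ω => 𝟙Q (upd e₁ e₂ false false ω)) = q := by
      rw [hq]; congr 1
    rw [t1, t2, t3, t4]; ring
  -- `D` and `D_o`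
  have hprob00 : ∀ A : Set (Config E), prob p (A ∩ closedEdge e₁ ∩ closedEdge e₂) =
      (1 - p e₁) * (1 - p e₂) * expect p (fun ω => A.indicator 1 (base e₁ e₂ ω)) := by
    intro A
    rw [prob_inter_closedEdge, prob_inter_closedEdge, Function.update_of_ne h.ne,
      prob_eq_expect_indicator, expect_update_zero, expect_update_zero]
    simp only [base]
    ring
  have hD : D = (1 - p e₁) * (1 - p e₂) * q := by
    rw [PDEvent_eq_two_root h, hprob00, hq]
  have hDo : Dₒ = (1 - p e₁) * (1 - p e₂) * (M + Z) := by
    unfold CovForm.Do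
    rw [PDEvent_eq_two_root h,
      show Q ∩ closedEdge e₁ ∩ closedEdge e₂ ∩ connEvent ends a₁ o =
        (Q ∩ connEvent ends a₁ o) ∩ closedEdge e₁ ∩ closedEdge e₂ from by
        ext ω; simp only [Set.mem_inter_iff]; tauto,
      show Q ∩ closedEdge e₁ ∩ closedEdge e₂ ∩ connEvent ends a₂ o =
        (Q ∩ connEvent ends a₂ o) ∩ closedEdge e₁ ∩ closedEdge e₂ from by
        ext ω; simp only [Set.mem_inter_iff]; tauto,
      hprob00, hprob00, hM, hZ]
    have i1 : ∀ ω : Config E, (Q ∩ connEvent ends a₁ o).indicator (1 : Config E → R) (base e₁ e₂ ω) =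
        𝟙o₁ (base e₁ e₂ ω) * 𝟙Q (base e₁ e₂ ω) := by
      intro ω; rw [← CaseOne.ind_mul, mul_comm]
    have i2 : ∀ ω : Config E, (Q ∩ connEvent ends a₂ o).indicator (1 : Config E → R) (base e₁ e₂ ω) =
        𝟙f (base e₁ e₂ ω) * 𝟙Q (base e₁ e₂ ω) := by
      intro ω; rw [← CaseOne.ind_mul, mul_comm]
    simp only [i1, i2]
    ring
  -- signs
  have hqn : 0 ≤ q := expect_nonneg hp fun ω => Set.indicator_apply_nonneg fun _ => zero_le_one
  have hMn : 0 ≤ M := expect_nonneg hp fun ω => mul_nonneg (Set.indicator_apply_nonneg fun _ => zero_le_one)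
    (Set.indicator_apply_nonneg fun _ => zero_le_one)
  -- BHK 1.4 (functional) in the case-1 world `p[e₂ ↦ 0][e₁ ↦ 1]`: `q X ≤ Y Z`
  have hBHK : q * X ≤ Y * Z := by
    set p' := Function.update (Function.update p e₂ 0) e₁ 1 with hp'def
    have hp' : IsProbVec p' := (hp.update e₂ le_rfl zero_le_one).update e₁ zero_le_one le_rfl
    have hE' : ∀ g : Config E → R, expect p' g = expect p (fun ω => g (upd e₁ e₂ true false ω)) := by
      intro g
      rw [hp'def, expect_update_one, expect_update_zero]
      rfl
    have hb := CaseOne.bhk_cross_cluster_fun p' hp' ends a₁ a₂ hG hG0 (isUpperSet_mem_setOf o)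
    rw [CovForm.compl_connEvent_eq_Q, ← connEvent_eq_clusterInEvent, prob_eq_expect_indicator,
      prob_eq_expect_indicator, hE', hE', hE', hE'] at hb
    have r1 : (fun ω => G (cluster ends (upd e₁ e₂ true false ω) a₁) *
        ({W : Set V | o ∈ W}).indicator (1 : Set V → R) (cluster ends (upd e₁ e₂ true false ω) a₂) *
        𝟙Q (upd e₁ e₂ true false ω)) =
        fun ω => G (cluster ends (upd e₁ e₂ true false ω) a₁) * 𝟙f (base e₁ e₂ ω) * 𝟙Q (base e₁ e₂ ω) := by
      funext ω
      rw [CaseOne.ind_cluster_eq, hfu_tf, hQ_tf]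
    have r2 : (fun ω => 𝟙Q (upd e₁ e₂ true false ω)) = fun ω => 𝟙Q (base e₁ e₂ ω) := by
      funext ω; rw [hQ_tf]
    have r3 : (fun ω => G (cluster ends (upd e₁ e₂ true false ω) a₁) * 𝟙Q (upd e₁ e₂ true false ω)) =
        fun ω => G (cluster ends (upd e₁ e₂ true false ω) a₁) * 𝟙Q (base e₁ e₂ ω) := by
      funext ω; rw [hQ_tf]
    have r4 : (fun ω => (connEvent ends a₂ o ∩ Q).indicator (1 : Config E → R)
        (upd e₁ e₂ true false ω)) = fun ω => 𝟙f (base e₁ e₂ ω) * 𝟙Q (base e₁ e₂ ω) := by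
      funext ω
      rw [← CaseOne.ind_mul, hfu_tf, hQ_tf]
    rw [r1, r2, r3, r4] at hb
    rw [hX, hY, hZ, hq]
    linarith [hb]
  -- monotonicity: `Y0 ≤ Y`
  have hYY : Y0 ≤ Y := by
    refine expect_mono hp fun ω => ?_
    exact mul_le_mul_of_nonneg_right
      (hG (cluster_mono (update_false_le_update_true (Function.update ω e₂ false) e₁) a₁))
      (Set.indicator_apply_nonneg fun _ => zero_le_one)
  -- the algebra
  rw [hE1, hE2, hE3, hE4, hE5, hD, hDo, hPQ]
  have key : (1 - p e₁ * p e₂) * q *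
      ((1 - p e₁) * (1 - p e₂) * q * (p e₁ * (1 - p e₂) * X) -
        (1 - p e₁) * (1 - p e₂) * (M + Z) * (p e₁ * (1 - p e₂) * Y)) -
      (p e₁ * (1 - p e₂) * Y + (1 - p e₁) * Y0) *
        ((1 - p e₁) * (1 - p e₂) * q * (p e₁ * (1 - p e₂) * Z) -
          (1 - p e₁) * (1 - p e₂) * (M + Z) * (p e₁ * (1 - p e₂) * q)) =
      p e₁ * (1 - p e₂) * ((1 - p e₁) * (1 - p e₂)) * q *
        ((1 - p e₁ * p e₂) * (q * X - Y * Z) - (1 - p e₁) * M * (Y - Y0)) := by ring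
  rw [key]
  have hc : 0 ≤ p e₁ * (1 - p e₂) * ((1 - p e₁) * (1 - p e₂)) * q :=
    mul_nonneg (mul_nonneg (mul_nonneg hp1 (sub_nonneg.2 hp2'))
      (mul_nonneg (sub_nonneg.2 hp1') (sub_nonneg.2 hp2'))) hqn
  apply mul_nonpos_of_nonneg_of_nonpos hc
  have h1 : 0 ≤ 1 - p e₁ * p e₂ := by nlinarith
  have h2 : (1 - p e₁ * p e₂) * (q * X - Y * Z) ≤ 0 :=
    mul_nonpos_of_nonneg_of_nonpos h1 (by linarith)
  have h3 : 0 ≤ (1 - p e₁) * M * (Y - Y0) :=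
    mul_nonneg (mul_nonneg (sub_nonneg.2 hp1') hMn) (sub_nonneg.2 hYY)
  linarith

end TwoRootMain

end SLevel

end Summit.Ventures.PercRepro2
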